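import Mathlib.Analysis.ODE.ExistUnique
import Mathlib.Analysis.Calculus.ContDiff.RCLike
import Mathlib.Analysis.InnerProductSpace.Calculus
import Mathlib.MeasureTheory.Integral.IntervalIntegral.FundThmCalculus
import Literature.Analysis.FunctionSpaces.PotentialDynamics
import Literature.Analysis.FunctionSpaces.PotentialDynamicsEuclideanFlowProofs
import Literature.Analysis.FluidPDE.HardSphereRegularGeometry
import HarnessLib

/-!
# Discharged fact: uniqueness of the `N`-body potential flow on the flat torus

`Literature.Analysis.FunctionSpaces.PotentialDynamics` records, as the named fact
`PotentialFlow.eqOn_of_mem_good_torus`, that for `0 < ε < 1/2` two potential flows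
(`PotentialFlow (Torus.geometry d) Φ ε N`, Gallagher–Saint-Raymond–Texier, Part III) agree at
all times on the intersection of their good sets. This file proves it
(`PotentialFlow.eqOn_of_mem_good_torus_holds`) by the Cauchy–Lipschitz argument the source
alludes to (arXiv:1208.5753, Part I Ch. 1 §1, the Hamiltonian system; Part III Ch. 9 intro, the
phase space `Ω_N = {x_i ≠ x_j}`; Ch. 8 §2: "uniqueness of the trajectory … a consequence of the
regularity assumption on the potential, via the Cauchy-Lipschitz theorem"):

* *Lift.* A Hamiltonian trajectory `γ` on `(T^d × ℝ^d)^N` (`IsHamiltonianTrajectory`: Newton's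
  law for the velocities, positions = initial positions translated by the integrated velocity)
  lifts to the curve `Y(t) = ((∫₀ᵗ v_i)_i, (v_i(t))_i)` in the Banach space
  `(Fin N → ℝ^d) × (Fin N → ℝ^d)`, which solves the autonomous ODE `Ẏ = W(Y)`,
  `W(q, v) = (v, (-∑_{j ≠ i} ∇Φ_ε(reprSym((x_i⁰ - x_j⁰) + proj(q_i - q_j))))_i)`
  (`IsHamiltonianTrajectory.hasDerivAt_lift`; fundamental theorem of calculus for the
  positions).
* *Local smoothness of the force.* `Φ_ε = φ(|·|/ε)` is `C²` off the origin (`φ` is `C²` on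
  `(0, ∞)`), so `∇Φ_ε` is `C¹` there (`ShortRangePotential.contDiffAt_gradient_scaled` of the
  whole-space companion `PotentialDynamicsEuclideanFlowProofs`); `∇Φ_ε` vanishes identically near
  any point of norm `> ε` (finite range, `ShortRangePotential.gradient_scaled_eventuallyEq_zero`). On the torus the minimal image `reprSym` is discontinuous on the cut locus,
  but for `ε < 1/2` this is harmless: near a configuration with `|reprSym| > ε` the pair force is
  identically `0` (continuity of the minimal-image *distance*, `Torus.continuous_norm_reprSym`),
  and near one with `0 < |reprSym| ≤ ε < 1/2` the minimal image is the affine chart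
  `reprSym(x + proj s) = reprSym x + s` (`Torus.reprSym_add_proj`). Hence `W` is `C¹` at every
  point whose configuration is non-coincident (`PotentialFlow.contDiffAt_liftField`).
* *Uniqueness.* `C¹ ⇒` locally Lipschitz (`ContDiffAt.exists_lipschitzOnWith`), so by Mathlib's
  Grönwall-based `ODE_solution_unique_of_eventually` two lifts that agree at some time agree
  nearby; the coincidence set `{t | Y₁ t = Y₂ t}` is clopen and contains `0`, hence is `ℝ`
  (`IsHamiltonianTrajectory.eq_of_noCoincidence_torus`). Orbits of good points stay in the good
  set `⊆ noCoincidence` (`mapsTo_good`, `good_subset`) and start at `z` (`flow_zero`), which gives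
  the fact.

## Mathlib / Literature reuse

`ODE_solution_unique_of_eventually`, `ContDiffAt.exists_lipschitzOnWith`,
`Continuous.integral_hasStrictDerivAt`, `IsClopen.eq_univ` are Mathlib's;
`ShortRangePotential.contDiffAt_gradient_scaled` (`∇Φ_ε` is `C¹` off the origin) is the
whole-space companion file `PotentialDynamicsEuclideanFlowProofs`'s (which discharges
`eqOn_of_mem_good_euclidean` by the same Cauchy–Lipschitz scheme on the phase space itself; on
the torus positions have no derivative, whence the lift below); `Torus.reprSym_add_proj`,
`Torus.abs_reprSym_apply_le_norm`, `Torus.continuous_norm_reprSym` are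
`Literature.Analysis.FluidPDE.HardSphereRegularGeometry`'s. No new definition, no new named fact.

## References

* I. Gallagher, L. Saint-Raymond, B. Texier, *From Newton to Boltzmann: hard spheres and
  short-range potentials*, arXiv:1208.5753 (EMS Zurich Lectures, 2013): Part I Ch. 1 §1
  (Hamiltonian system), Assumption 2.1 (= EMS Assumption 1.2.1); Part III Ch. 9 introduction
  (Liouville equation on `Ω_N`); Part III Ch. 8 §2 (Cauchy–Lipschitz uniqueness of trajectories).
-/

open MeasureTheory Metric Set Filter Topology
open scoped InnerProductSpace NNReal

namespace Literature.Analysis.FunctionSpaces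

noncomputable section

variable {d : Type*} [Fintype d]

/-! ## The gradient of the scaled potential vanishes beyond the range -/

namespace ShortRangePotential

/-- Finite range: near a point of norm `> ε` (`0 < ε`) the gradient `∇Φ_ε` vanishes identically
(`Φ_ε = 0` on the open set `{|x| > ε}`, `scaled_eq_zero`). [folklore] -/
theorem gradient_scaled_eventuallyEq_zero (Φ : ShortRangePotential d) {ε : ℝ} (hε : 0 < ε)
    {x : EuclideanSpace ℝ d} (hx : ε < ‖x‖) :
    gradient (Φ.scaled ε) =ᶠ[𝓝 x] fun _ => 0 := by
  have hopen : IsOpen {y : EuclideanSpace ℝ d | ε < ‖y‖} :=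
    isOpen_lt continuous_const continuous_norm
  filter_upwards [hopen.mem_nhds hx] with y hy
  have h : Φ.scaled ε =ᶠ[𝓝 y] fun _ => (0 : ℝ) :=
    Filter.eventually_of_mem (hopen.mem_nhds hy) fun z hz => Φ.scaled_eq_zero hε (le_of_lt hz)
  rw [h.gradient_eq]
  exact gradient_fun_const _ _

end ShortRangePotential

/-! ## The lifted vector field on the torus -/

namespace PotentialFlow

variable {N : ℕ} {Φ : ShortRangePotential d} {ε : ℝ}

omit [Fintype d] in
/-- Additivity of the covering map, rearranged: `(a + proj u) - (b + proj w) = (a - b) + proj (u - w)`.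
[folklore] -/
theorem add_proj_sub_add_proj (a b : UnitAddTorus d) (u w : EuclideanSpace ℝ d) :
    (a + Torus.proj u) - (b + Torus.proj w) = (a - b) + Torus.proj (u - w) := by
  rw [sub_eq_add_neg u w, Torus.proj_add, Torus.proj_neg]
  abel

/-- **Local smoothness of the pair force through the minimal image.** For `0 < ε < 1/2`, a point
`p` of the torus and a map `h` into `ℝ^d` which is `C¹` at `y₀` with
`reprSym (p + proj (h y₀)) ≠ 0`, the map `y ↦ ∇Φ_ε (reprSym (p + proj (h y)))` is `C¹` at `y₀`:
if `|reprSym (p + proj (h y₀))| > ε` it vanishes near `y₀` (continuity of the minimal-image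
distance and finite range), and otherwise every coordinate of the minimal image is `≤ ε < 1/2` in
absolute value, so that near `y₀` the minimal image is the affine chart
`reprSym (p + proj (h y)) = reprSym (p + proj (h y₀)) + (h y - h y₀)` (`Torus.reprSym_add_proj`),
on which `∇Φ_ε` is `C¹` off the origin. This is the precise content of "for `ε < 1/2` the
minimal-image separation is smooth on the support of `Φ_ε`" (GST 2013 Ch. 4 intro). [folklore] -/
theorem contDiffAt_gradient_scaled_reprSym {E' : Type*} [NormedAddCommGroup E']
    [NormedSpace ℝ E'] (Φ : ShortRangePotential d) (hε : 0 < ε) (hε' : ε < 2⁻¹)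
    (p : UnitAddTorus d) {h : E' → EuclideanSpace ℝ d} {y₀ : E'} (hh : ContDiffAt ℝ 1 h y₀)
    (h0 : FluidPDE.Torus.reprSym (p + Torus.proj (h y₀)) ≠ 0) :
    ContDiffAt ℝ 1
      (fun y => gradient (Φ.scaled ε) (FluidPDE.Torus.reprSym (p + Torus.proj (h y)))) y₀ := by
  have hcont : ContinuousAt h y₀ := hh.continuousAt
  rcases lt_or_ge ε ‖FluidPDE.Torus.reprSym (p + Torus.proj (h y₀))‖ with hlt | hle
  · -- beyond the range: the pair force vanishes near `y₀`
    have hc : ContinuousAt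
        (fun y => ‖FluidPDE.Torus.reprSym (p + Torus.proj (h y))‖) y₀ :=
      (FluidPDE.Torus.continuous_norm_reprSym.comp
        (continuous_const.add Torus.continuous_proj)).continuousAt.comp hcont
    have hev : ∀ᶠ y in 𝓝 y₀, ε < ‖FluidPDE.Torus.reprSym (p + Torus.proj (h y))‖ :=
      hc.eventually_mem (Ioi_mem_nhds hlt)
    refine (contDiffAt_const (c := (0 : EuclideanSpace ℝ d))).congr_of_eventuallyEq ?_
    filter_upwards [hev] with y hy
    exact (Φ.gradient_scaled_eventuallyEq_zero hε hy).eq_of_nhds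
  · -- within the range: the minimal image is an affine chart near `y₀`
    have hδ : 0 < 2⁻¹ - ε := sub_pos.mpr hε'
    have hev : ∀ᶠ y in 𝓝 y₀, dist (h y) (h y₀) < 2⁻¹ - ε :=
      Metric.tendsto_nhds.1 hcont _ hδ
    have hchart : ∀ᶠ y in 𝓝 y₀, FluidPDE.Torus.reprSym (p + Torus.proj (h y)) =
        FluidPDE.Torus.reprSym (p + Torus.proj (h y₀)) + (h y - h y₀) := by
      filter_upwards [hev] with y hy
      have hsplit : p + Torus.proj (h y) = (p + Torus.proj (h y₀)) + Torus.proj (h y - h y₀) := by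
        rw [add_assoc, ← Torus.proj_add, add_sub_cancel]
      rw [hsplit]
      refine FluidPDE.Torus.reprSym_add_proj fun i => ?_
      have h1 : |FluidPDE.Torus.reprSym (p + Torus.proj (h y₀)) i| ≤ ε :=
        (FluidPDE.Torus.abs_reprSym_apply_le_norm _ i).trans hle
      have h2 : |(h y - h y₀) i| < 2⁻¹ - ε := by
        refine lt_of_le_of_lt ?_ (dist_eq_norm (h y) (h y₀) ▸ hy)
        simpa using PiLp.norm_apply_le (h y - h y₀) i
      rw [abs_le] at h1
      rw [abs_lt] at h2
      constructor <;> linarith [h1.1, h1.2, h2.1, h2.2]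
    have hsm : ContDiffAt ℝ 1 (fun y => gradient (Φ.scaled ε)
        (FluidPDE.Torus.reprSym (p + Torus.proj (h y₀)) + (h y - h y₀))) y₀ := by
      have hr0 : FluidPDE.Torus.reprSym (p + Torus.proj (h y₀)) + (h y₀ - h y₀) ≠ 0 := by
        rwa [sub_self, add_zero]
      exact ContDiffAt.comp (g := gradient (Φ.scaled ε))
        (f := fun y => FluidPDE.Torus.reprSym (p + Torus.proj (h y₀)) + (h y - h y₀)) y₀
        (Φ.contDiffAt_gradient_scaled ε hr0) (contDiffAt_const.add (hh.sub contDiffAt_const))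
    exact hsm.congr_of_eventuallyEq
      (hchart.mono fun y hy => congrArg (gradient (Φ.scaled ε)) hy)

/-- **The lifted vector field is `C¹` off coincidences.** For `0 < ε < 1/2` and base positions
`a : Fin N → T^d`, the vector field `W(q, v) = (v, (-∑_{j ≠ i} ∇Φ_ε (reprSym ((a_i - a_j) +
proj (q_i - q_j))))_i)` of the lifted `N`-body system is `C¹` at every point `(q, v)` whose
configuration `(a_i + proj q_i)_i` has no coincident pair (`contDiffAt_gradient_scaled_reprSym`
summand by summand). [folklore] -/
theorem contDiffAt_liftField (Φ : ShortRangePotential d) (hε : 0 < ε) (hε' : ε < 2⁻¹)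
    (a : Fin N → UnitAddTorus d)
    {y₀ : (Fin N → EuclideanSpace ℝ d) × (Fin N → EuclideanSpace ℝ d)}
    (hy₀ : ∀ i j, i ≠ j →
      FluidPDE.Torus.reprSym ((a i - a j) + Torus.proj (y₀.1 i - y₀.1 j)) ≠ 0) :
    ContDiffAt ℝ 1
      (fun y : (Fin N → EuclideanSpace ℝ d) × (Fin N → EuclideanSpace ℝ d) =>
        ((y.2, fun i => -∑ j ∈ Finset.univ.erase i, gradient (Φ.scaled ε)
          (FluidPDE.Torus.reprSym ((a i - a j) + Torus.proj (y.1 i - y.1 j)))) :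
          (Fin N → EuclideanSpace ℝ d) × (Fin N → EuclideanSpace ℝ d))) y₀ := by
  refine contDiffAt_snd.prodMk (contDiffAt_pi.2 fun i => ?_)
  refine ContDiffAt.neg (ContDiffAt.sum fun j hj => ?_)
  have hij : i ≠ j := (Finset.ne_of_mem_erase hj).symm
  have hh : ContDiffAt ℝ 1
      (fun y : (Fin N → EuclideanSpace ℝ d) × (Fin N → EuclideanSpace ℝ d) => y.1 i - y.1 j) y₀ :=
    (contDiffAt_pi.1 contDiffAt_fst i).sub (contDiffAt_pi.1 contDiffAt_fst j)
  exact contDiffAt_gradient_scaled_reprSym Φ hε hε' (a i - a j) hh (hy₀ i j hij)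

/-- Along a Hamiltonian trajectory on the torus the separation vector of particles `i, j` at
time `t` is the minimal image of the initial separation moved by the integrated relative
velocity: `sep(x_i(t), x_j(t)) = reprSym ((x_i(0) - x_j(0)) + proj (∫₀ᵗ v_i - ∫₀ᵗ v_j))`
(`pos_eq` and additivity of `proj`). [folklore] -/
theorem _root_.Literature.Analysis.FunctionSpaces.IsHamiltonianTrajectory.sepVec_pos_eq
    {γ : ℝ → FluidPDE.Config N d (UnitAddTorus d)}
    (h : IsHamiltonianTrajectory (FluidPDE.Torus.geometry d) Φ ε N γ) (t : ℝ) (i j : Fin N) :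
    (FluidPDE.Torus.geometry d).sepVec ((γ t).pos i) ((γ t).pos j) =
      FluidPDE.Torus.reprSym (((γ 0).pos i - (γ 0).pos j) +
        Torus.proj ((∫ s in (0 : ℝ)..t, (γ s).vel i) - ∫ s in (0 : ℝ)..t, (γ s).vel j)) := by
  rw [h.pos_eq t i, h.pos_eq t j, FluidPDE.Torus.geometry_sepVec,
    FluidPDE.Torus.geometry_translate, FluidPDE.Torus.geometry_translate, add_proj_sub_add_proj]

/-- **The lift solves the lifted ODE.** Along a Hamiltonian trajectory `γ` on the torus the curve
`Y(t) = ((∫₀ᵗ v_i)_i, (v_i(t))_i)` has derivative `W(Y(t))` at every `t`: the first component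
by the fundamental theorem of calculus (the velocities are differentiable, hence continuous),
the second by Newton's law `vel_hasDerivAt` rewritten through `sepVec_pos_eq`. [folklore] -/
theorem _root_.Literature.Analysis.FunctionSpaces.IsHamiltonianTrajectory.hasDerivAt_lift
    {γ : ℝ → FluidPDE.Config N d (UnitAddTorus d)}
    (h : IsHamiltonianTrajectory (FluidPDE.Torus.geometry d) Φ ε N γ) (t : ℝ) :
    HasDerivAt
      (fun t => (((fun i => ∫ s in (0 : ℝ)..t, (γ s).vel i), fun i => (γ t).vel i) :
        (Fin N → EuclideanSpace ℝ d) × (Fin N → EuclideanSpace ℝ d)))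
      ((fun i => (γ t).vel i), fun i => -∑ j ∈ Finset.univ.erase i, gradient (Φ.scaled ε)
        (FluidPDE.Torus.reprSym (((γ 0).pos i - (γ 0).pos j) +
          Torus.proj ((∫ s in (0 : ℝ)..t, (γ s).vel i) - ∫ s in (0 : ℝ)..t, (γ s).vel j))))
      t := by
  refine HasDerivAt.prodMk (hasDerivAt_pi.2 fun i => ?_) (hasDerivAt_pi.2 fun i => ?_)
  · have hc : Continuous fun s => (γ s).vel i :=
      continuous_iff_continuousAt.2 fun s => (h.vel_hasDerivAt s i).continuousAt
    exact (hc.integral_hasStrictDerivAt 0 t).hasDerivAt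
  · refine (h.vel_hasDerivAt t i).congr_deriv ?_
    show -∑ j ∈ Finset.univ.erase i, gradient (Φ.scaled ε)
        ((FluidPDE.Torus.geometry d).sepVec ((γ t).pos i) ((γ t).pos j)) = _
    exact congrArg Neg.neg (Finset.sum_congr rfl fun j _ => by rw [h.sepVec_pos_eq t i j])

/-- **Cauchy–Lipschitz uniqueness of Hamiltonian trajectories on the torus.** For
`0 < ε < 1/2`, two Hamiltonian trajectories of the `N`-body system with pair potential `Φ_ε`
on `T^d` which agree at time `0`, one of which never passes through a coincidence, are equal
(GST: "uniqueness of the trajectory … via the Cauchy-Lipschitz theorem"). Proof: the lifts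
`Y₁, Y₂` solve the same ODE `Ẏ = W(Y)` (`hasDerivAt_lift`) with `W` of class `C¹`, hence
locally Lipschitz, near every `Y₁ t` (`contDiffAt_liftField`); by
`ODE_solution_unique_of_eventually` the closed set `{t | Y₁ t = Y₂ t}` is open, it contains
`0`, so it is all of `ℝ`; positions and velocities are read off the lifts (`pos_eq`). [cite: GallagherSaintraymondTexier2012, Part III Ch. 8 §2 (Cauchy–Lipschitz uniqueness of trajectories) & Ch. 9 intro (Hamiltonian system on Ω_N); Part I Ch. 1 §1] -/
theorem _root_.Literature.Analysis.FunctionSpaces.IsHamiltonianTrajectory.eq_of_noCoincidence_torus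
    (hε : 0 < ε) (hε' : ε < 2⁻¹) {γ₁ γ₂ : ℝ → FluidPDE.Config N d (UnitAddTorus d)}
    (h₁ : IsHamiltonianTrajectory (FluidPDE.Torus.geometry d) Φ ε N γ₁)
    (h₂ : IsHamiltonianTrajectory (FluidPDE.Torus.geometry d) Φ ε N γ₂)
    (hnc : ∀ t, γ₁ t ∈ noCoincidence (FluidPDE.Torus.geometry d) N) (h0 : γ₁ 0 = γ₂ 0) :
    γ₁ = γ₂ := by
  classical
  -- the lifted vector field (base point `γ₁ 0`) and the two lifts
  obtain ⟨W, hW⟩ : ∃ W : (Fin N → EuclideanSpace ℝ d) × (Fin N → EuclideanSpace ℝ d) →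
      (Fin N → EuclideanSpace ℝ d) × (Fin N → EuclideanSpace ℝ d),
      W = fun y => (y.2, fun i => -∑ j ∈ Finset.univ.erase i, gradient (Φ.scaled ε)
        (FluidPDE.Torus.reprSym (((γ₁ 0).pos i - (γ₁ 0).pos j) +
          Torus.proj (y.1 i - y.1 j)))) :=
    ⟨_, rfl⟩
  obtain ⟨Y₁, hY₁⟩ : ∃ Y : ℝ → (Fin N → EuclideanSpace ℝ d) × (Fin N → EuclideanSpace ℝ d),
      Y = fun t => ((fun i => ∫ s in (0 : ℝ)..t, (γ₁ s).vel i), fun i => (γ₁ t).vel i) :=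
    ⟨_, rfl⟩
  obtain ⟨Y₂, hY₂⟩ : ∃ Y : ℝ → (Fin N → EuclideanSpace ℝ d) × (Fin N → EuclideanSpace ℝ d),
      Y = fun t => ((fun i => ∫ s in (0 : ℝ)..t, (γ₂ s).vel i), fun i => (γ₂ t).vel i) :=
    ⟨_, rfl⟩
  -- both lifts solve `Ẏ = W(Y)`
  have hd₁ : ∀ t, HasDerivAt Y₁ (W (Y₁ t)) t := fun t => by
    rw [hY₁, hW]
    exact h₁.hasDerivAt_lift t
  have hd₂ : ∀ t, HasDerivAt Y₂ (W (Y₂ t)) t := fun t => by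
    rw [hY₂, hW, h0]
    exact h₂.hasDerivAt_lift t
  have hc₁ : Continuous Y₁ := continuous_iff_continuousAt.2 fun t => (hd₁ t).continuousAt
  have hc₂ : Continuous Y₂ := continuous_iff_continuousAt.2 fun t => (hd₂ t).continuousAt
  -- `W` is `C¹` at every point of the first lift (no coincidences along `γ₁`)
  have hWs : ∀ t, ContDiffAt ℝ 1 W (Y₁ t) := fun t => by
    rw [hW]
    refine contDiffAt_liftField Φ hε hε' (fun i => (γ₁ 0).pos i) fun i j hij => ?_
    have hne := hnc t i j hij
    rw [h₁.sepVec_pos_eq t i j] at hne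
    rw [hY₁]
    exact hne
  -- same initial value
  have hY0 : Y₁ 0 = Y₂ 0 := by
    rw [hY₁, hY₂]
    simp only [intervalIntegral.integral_same, h0]
  -- the coincidence set of the lifts is clopen and nonempty, hence everything
  have hS : IsClopen {t : ℝ | Y₁ t = Y₂ t} := by
    refine ⟨isClosed_eq hc₁ hc₂, isOpen_iff_mem_nhds.2 fun t₀ ht₀ => ?_⟩
    have ht₀' : Y₁ t₀ = Y₂ t₀ := ht₀
    obtain ⟨K, s, hs, hK⟩ := (hWs t₀).exists_lipschitzOnWith
    have hs₁ : ∀ᶠ t in 𝓝 t₀, Y₁ t ∈ s := hc₁.continuousAt.eventually_mem hs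
    have hs₂ : ∀ᶠ t in 𝓝 t₀, Y₂ t ∈ s := hc₂.continuousAt.eventually_mem (ht₀' ▸ hs)
    exact ODE_solution_unique_of_eventually (v := fun _ => W) (s := fun _ => s)
      (Eventually.of_forall fun _ => hK) (hs₁.mono fun t ht => ⟨hd₁ t, ht⟩)
      (hs₂.mono fun t ht => ⟨hd₂ t, ht⟩) ht₀'
  have hall : ∀ t, Y₁ t = Y₂ t := fun t => by
    have ht : t ∈ {t : ℝ | Y₁ t = Y₂ t} := by
      rw [hS.eq_univ ⟨0, hY0⟩]
      exact mem_univ t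
    exact ht
  -- read off positions and velocities
  funext t
  have ht := hall t
  rw [hY₁, hY₂] at ht
  simp only [Prod.mk.injEq] at ht
  obtain ⟨hq, hv⟩ := ht
  funext i
  refine Prod.ext ?_ ?_
  · have hqi : (∫ s in (0 : ℝ)..t, (γ₁ s).vel i) = ∫ s in (0 : ℝ)..t, (γ₂ s).vel i :=
      congrFun hq i
    show (γ₁ t).pos i = (γ₂ t).pos i
    rw [h₁.pos_eq t i, h₂.pos_eq t i, h0, hqi]
  · show (γ₁ t).vel i = (γ₂ t).vel i
    exact congrFun hv i

/-- **Discharge of the named fact `PotentialFlow.eqOn_of_mem_good_torus`** (uniqueness of the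
potential flow on the good set, flat torus, `0 < ε < 1/2`): the orbits `t ↦ Ψ₁.flow t z` and
`t ↦ Ψ₂.flow t z` of a point `z` of both good sets are Hamiltonian trajectories
(`isTrajectory`) starting at `z` (`flow_zero`), and the first one stays in
`Ψ₁.good ⊆ noCoincidence` (`mapsTo_good`, `good_subset`); conclude by
`IsHamiltonianTrajectory.eq_of_noCoincidence_torus` (Cauchy–Lipschitz, GST 2013 Part III). [cite: GallagherSaintraymondTexier2012, Part III Ch. 9 intro & Ch. 8 §2 (Cauchy–Lipschitz); Part I Ch. 1 §1] -/
theorem eqOn_of_mem_good_torus_holds :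
    eqOn_of_mem_good_torus (d := d) (N := N) (Φ := Φ) (ε := ε) := by
  intro hε hε' Ψ₁ Ψ₂ z hz t
  have h := IsHamiltonianTrajectory.eq_of_noCoincidence_torus hε hε'
    (Ψ₁.isTrajectory z hz.1) (Ψ₂.isTrajectory z hz.2)
    (fun s => Ψ₁.good_subset (Ψ₁.mapsTo_good s hz.1))
    (by simp only [Ψ₁.flow_zero z hz.1, Ψ₂.flow_zero z hz.2])
  exact congrFun h t

end PotentialFlow

end

end Literature.Analysis.FunctionSpaces
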